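import Literature.MathematicalPhysics.KineticTheory.ReyBelletThomas2002LimitCascade
import Mathlib.Topology.ContinuousMap.Bounded.ArzelaAscoli
import Mathlib.Topology.MetricSpace.UniformConvergence
import HarnessLib

/-!
# Rey-Bellet–Thomas 2002, Theorem 3.3 (regime `k₁ = k₂`): the uniform high-energy dissipation bound

Trunk T-KINETIC (Literature/MathematicalPhysics/KineticTheory). Inline step towards Theorem 3.10 for
the named fact `ReyBelletThomas2002_thm21` (provefact unit). Theorem 3.3 and the passage to
`E = ∞` on p. 17 ("Using again that the solution of O.D.E depends smoothly on its parameters, we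
obtain `inf_{E>E₀} inf_{x̃ ∈ {G̃_E = 1}} ∫₀^τ r̃² > c`"), in the regime `k₁ = k₂ = k` where the
printed compactness argument is sound, proved by SEQUENTIAL COMPACTNESS: were the bound to fail
along `E_n → ∞`, the rescaled (noisy, small-noise) trajectories would have equi-Lipschitz
noise-free parts, a uniformly convergent subsequence (Arzelà–Ascoli) whose limit solves the
limiting equations (21)/(22) with vanishing dissipation, hence starts at the trivial critical
point (`limit_initial_eq_zero`, `ReyBelletThomas2002LimitCascade.lean`) — contradicting the
convergence of the rescaled energies `G̃_{E_n}(x̃_n(0)) → G̃_∞(y*(0))` from `[1/2, 2]`.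

* `exists_subseq_tendsto_of_lipschitz` — **Arzelà–Ascoli extraction**: a uniformly bounded,
  uniformly Lipschitz sequence of paths on `[a, b]` in a finite-dimensional space has a uniformly
  convergent subsequence with a continuous limit;
* `scaled_apriori`, `scaled_drift_bound` — a-priori bounds on `{G̃_E ≤ M}` for `E ≥ 1`
  (positions, momenta, `E^{1/k-1/2}|r̃|`, and the rescaled drift (20));
* `norm_rbDriftOf_sub_rbDriftOf_le` — two reservoir drifts with close forces and close reservoir
  coefficients are uniformly close on bounded sets (the passage `Ỹ_E → Y_∞`);
* `rbScaledEnergy_le_of_norm_le` — small points have small rescaled energy, uniformly in `E ≥ 1`;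
* `scaled_core_seq` — the sequential compactness contradiction described above;
* `scaled_dissipation_lower_bound` — **Theorem 3.3 / Corollary 3.6, quantitative rescaled form**:
  `E₀, δ₀, ε₁ > 0` with `∫₀^{Λ₀} (r̃_L² + r̃_R²) ≥ ε₁` for every `E ≥ E₀` and every rescaled
  controlled trajectory on `[0, Λ₀]` with `G̃_E(x̃(0)) ≥ 1/2`, `G̃_E ≤ M` along the path and
  control `sup ‖η̃‖ ≤ δ₀` (a large initial reservoir variable is handled directly by
  `reservoir_deviation_le`).

## References

* L. Rey-Bellet, L. E. Thomas, Comm. Math. Phys. **225** (2002) 305–329, Thm 3.3 (proof,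
  pp. 16–17).
* P. Carmona, Stoch. Proc. Appl. **117** (2007) 1076–1092, Lemma 5.2 (sequential version).
-/

noncomputable section

open MeasureTheory Filter Topology Set intervalIntegral BoundedContinuousFunction
open scoped NNReal

namespace Literature.MathematicalPhysics.KineticTheory.HeatConduction

/-! ### Arzelà–Ascoli extraction for equi-Lipschitz sequences of paths -/

section Extraction

variable {E : Type*} [NormedAddCommGroup E] [NormedSpace ℝ E] [FiniteDimensional ℝ E]

/-- **Arzelà–Ascoli extraction**: a sequence of paths `f n : ℝ → E` (finite-dimensional `E`)
uniformly bounded by `R` and uniformly `L`-Lipschitz on `[a, b]` (`a ≤ b`) has a subsequence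
converging uniformly on `[a, b]` to a continuous path `g` (which is `L`-Lipschitz on `[a, b]`).
[folklore] -/
theorem exists_subseq_tendsto_of_lipschitz {a b : ℝ} (hab : a ≤ b) {f : ℕ → ℝ → E} {R : ℝ} {L : ℝ≥0}
    (hbd : ∀ n, ∀ t ∈ Icc a b, ‖f n t‖ ≤ R)
    (hlip : ∀ n, LipschitzOnWith L (f n) (Icc a b)) :
    ∃ (g : ℝ → E) (φ : ℕ → ℕ), StrictMono φ ∧ Continuous g ∧
      (∀ s ∈ Icc a b, ∀ t ∈ Icc a b, ‖g s - g t‖ ≤ L * |s - t|) ∧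
      ∀ ε > 0, ∀ᶠ n in atTop, ∀ t ∈ Icc a b, ‖f (φ n) t - g t‖ ≤ ε := by
  haveI : Nonempty (Icc a b) := ⟨⟨a, le_rfl, hab⟩⟩
  -- the restrictions as bounded continuous functions on the compact interval
  have hlip' : ∀ n, LipschitzWith L (fun x : Icc a b => f n x) := fun n =>
    (hlip n).to_restrict
  set F : ℕ → (Icc a b →ᵇ E) := fun n =>
    BoundedContinuousFunction.mkOfCompact ⟨fun x : Icc a b => f n x, (hlip' n).continuous⟩ with hF
  have hFapply : ∀ n (x : Icc a b), F n x = f n x := fun n x => rfl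
  -- Arzelà–Ascoli: the closure of the range is compact
  set A : Set (Icc a b →ᵇ E) := Set.range F with hA
  have hin : ∀ (G : Icc a b →ᵇ E) (x : Icc a b), G ∈ A → G x ∈ Metric.closedBall (0 : E) R := by
    rintro G x ⟨n, rfl⟩
    rw [Metric.mem_closedBall, dist_zero_right, hFapply]
    exact hbd n x x.2
  have heq : Equicontinuous ((↑) : A → Icc a b → E) := by
    refine (LipschitzWith.uniformEquicontinuous ((↑) : A → Icc a b → E) L fun c => ?_).equicontinuous
    obtain ⟨n, hn⟩ := c.2
    have : ((c : A) : Icc a b → E) = fun x : Icc a b => f n x := by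
      funext x; rw [← hn]; rfl
    rw [this]
    exact hlip' n
  have hcpt : IsCompact (closure A) :=
    BoundedContinuousFunction.arzela_ascoli (Metric.closedBall (0 : E) R) (isCompact_closedBall _ _) A hin heq
  -- extract a convergent subsequence
  obtain ⟨G, -, φ, hφ, hlim⟩ := hcpt.tendsto_subseq (x := F) fun n => subset_closure ⟨n, rfl⟩
  have hunif : TendstoUniformly (fun n => ⇑(F (φ n))) G atTop :=
    BoundedContinuousFunction.tendsto_iff_tendstoUniformly.1 hlim
  -- the limit path, extended by constants outside `[a, b]`
  set g : ℝ → E := IccExtend hab G with hg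
  have hgc : Continuous g := G.continuous.Icc_extend'
  have hgmem : ∀ t (ht : t ∈ Icc a b), g t = G ⟨t, ht⟩ := fun t ht => IccExtend_of_mem hab G ht
  refine ⟨g, φ, hφ, hgc, ?_, ?_⟩
  · -- Lipschitz bound of the limit: pass to the limit in `‖f (φ n) s - f (φ n) t‖ ≤ L|s - t|`
    intro s hs t ht
    have hps : Tendsto (fun n => f (φ n) s) atTop (𝓝 (g s)) := by
      rw [hgmem s hs]
      have := hunif.tendsto_at ⟨s, hs⟩
      simpa [hFapply] using this
    have hpt : Tendsto (fun n => f (φ n) t) atTop (𝓝 (g t)) := by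
      rw [hgmem t ht]
      have := hunif.tendsto_at ⟨t, ht⟩
      simpa [hFapply] using this
    have hl : Tendsto (fun n => ‖f (φ n) s - f (φ n) t‖) atTop (𝓝 ‖g s - g t‖) := (hps.sub hpt).norm
    refine le_of_tendsto hl (Eventually.of_forall fun n => ?_)
    have := (hlip (φ n)).dist_le_mul s hs t ht
    rwa [dist_eq_norm, Real.dist_eq] at this
  · intro ε hε
    have h := (Metric.tendstoUniformly_iff.1 hunif) ε hε
    refine h.mono fun n hn t ht => ?_
    have := hn ⟨t, ht⟩
    rw [hgmem t ht, ← dist_eq_norm, dist_comm]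
    exact (by simpa [hFapply] using this.le)

end Extraction

/-! ### A-priori bounds in the rescaled variables (`E ≥ 1`) -/

section Apriori

open Literature.Analysis.ODE Literature.MathematicalPhysics.KineticTheory

variable {N : ℕ} {P : OscillatorChain} {k : ℝ} (hU : RBGrowth P.U k) (hV : RBGrowth P.V k)
  (hk : 2 ≤ k) (Λ : ℝ) (N)
include hU hV hk

/-- **A-priori bounds from a bound on the rescaled energy** (`E ≥ 1`, `k ≥ 2`): there are
`B, C_p, C_r ≥ 0` such that `G̃_E(x) ≤ M` implies `|q̃_i| ≤ B`, `|p̃_i| ≤ C_p` and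
`E^{1/k-1/2} |r̃_b| ≤ C_r` (so the friction term `E^{1/k-1/2} γ r̃` and the coupling term
`E^{2/k-1} Λ r̃` of (20) stay bounded). [cite: ReyBelletThomas2002, §3.1 (after eq. (19))] -/
theorem scaled_apriori (M : ℝ) : ∃ B C_p C_r : ℝ, 0 ≤ B ∧ 0 ≤ C_p ∧ 0 ≤ C_r ∧
    ∀ E : ℝ, 1 ≤ E → ∀ x : RBPhaseSpace N, P.rbScaledEnergy k E N x ≤ M →
      (∀ i, |x.1.1 i| ≤ B) ∧ (∀ i, |x.1.2 i| ≤ C_p) ∧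
      E ^ (1 / k - 1 / 2) * |x.2.1| ≤ C_r ∧ E ^ (1 / k - 1 / 2) * |x.2.2| ≤ C_r := by
  have hk0 : 0 < k := by linarith
  obtain ⟨CU, hCU, hUge⟩ := hU.scaledPot_ge hk0
  obtain ⟨CV, hCV, hVge⟩ := hV.scaledPot_ge hk0
  have haU := hU.coeff_pos
  have haV := hV.coeff_pos
  -- the constants
  set K : ℝ := max M 0 + N * CU + N ^ 2 * CV + CU with hK
  have hK0 : 0 ≤ K := by positivity
  refine ⟨(2 * K / hU.coeff + 1) ^ (1 / k), Real.sqrt (2 * K), Real.sqrt (2 * K),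
    Real.rpow_nonneg (by positivity) _, Real.sqrt_nonneg _, Real.sqrt_nonneg _, fun E hE x hx => ?_⟩
  have hE0 : 0 < E := by linarith
  -- lower bounds of the rescaled potentials for `E ≥ 1`
  have hUb : ∀ y, -CU ≤ (P.rbScaled k E).U y := fun y => by
    have h1 := hUge E hE0 y
    have h2 : CU / E ≤ CU := div_le_self hCU hE
    have h3 : 0 ≤ hU.coeff / 2 * |y| ^ k := by positivity
    simp only [OscillatorChain.rbScaled_U]; linarith
  have hVb : ∀ y, -CV ≤ (P.rbScaled k E).V y := fun y => by
    have h1 := hVge E hE0 y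
    have h2 : CV / E ≤ CV := div_le_self hCV hE
    have h3 : 0 ≤ hV.coeff / 2 * |y| ^ k := by positivity
    simp only [OscillatorChain.rbScaled_V]; linarith
  -- the Hamiltonian part is at most `M` and at least `-(N CU + N² CV)`
  have hr0 : 0 ≤ E ^ (2 / k - 1) * ((x.2.1 ^ 2 + x.2.2 ^ 2) / 2) := by positivity
  have hH : (P.rbScaled k E).hamiltonian N x.1 ≤ max M 0 := by
    have : P.rbScaledEnergy k E N x = E ^ (2 / k - 1) * ((x.2.1 ^ 2 + x.2.2 ^ 2) / 2) +
      (P.rbScaled k E).hamiltonian N x.1 := rfl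
    linarith [le_max_left M 0]
  have hkin := (P.rbScaled k E).kinetic_le_hamiltonian (by linarith : -CV ≤ 0) hUb hVb N x.1
  have hsum0 : 0 ≤ ∑ i, x.1.2 i ^ 2 / 2 := Finset.sum_nonneg fun i _ => by positivity
  have hHlow : -(N * CU + N ^ 2 * CV) ≤ (P.rbScaled k E).hamiltonian N x.1 := by nlinarith
  refine ⟨fun i => ?_, fun i => ?_, ?_, ?_⟩
  · -- positions
    have h1 := (P.rbScaled k E).sq_add_U_le_hamiltonian (by linarith : -CU ≤ 0) (by linarith : -CV ≤ 0) hUb hVb N x.1 i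
    have h2 := hUge E hE0 (x.1.1 i)
    simp only [OscillatorChain.rbScaled_U] at h1
    have h3 : CU / E ≤ CU := div_le_self hCU hE
    have hp0 : 0 ≤ x.1.2 i ^ 2 / 2 := by positivity
    have h4 : hU.coeff / 2 * |x.1.1 i| ^ k ≤ K := by rw [hK]; nlinarith [le_max_left M 0, le_max_right M 0]
    have h5 : |x.1.1 i| ^ k ≤ 2 * K / hU.coeff + 1 := by
      rw [div_add_one haU.ne', le_div_iff₀ haU]; nlinarith
    calc |x.1.1 i| = (|x.1.1 i| ^ k) ^ (1 / k) := by
          rw [← Real.rpow_mul (abs_nonneg _), mul_one_div_cancel hk0.ne', Real.rpow_one]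
      _ ≤ (2 * K / hU.coeff + 1) ^ (1 / k) :=
          Real.rpow_le_rpow (Real.rpow_nonneg (abs_nonneg _) _) h5 (by positivity)
  · -- momenta
    have h1 := (P.rbScaled k E).sq_add_U_le_hamiltonian (by linarith : -CU ≤ 0) (by linarith : -CV ≤ 0) hUb hVb N x.1 i
    have h2 := hUb (x.1.1 i)
    have h4 : x.1.2 i ^ 2 ≤ 2 * K := by rw [hK]; nlinarith [le_max_left M 0, le_max_right M 0]
    calc |x.1.2 i| = Real.sqrt (x.1.2 i ^ 2) := (Real.sqrt_sq_eq_abs _).symm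
      _ ≤ Real.sqrt (2 * K) := Real.sqrt_le_sqrt h4
  · -- `r_L`
    have h4 : E ^ (2 / k - 1) * x.2.1 ^ 2 ≤ 2 * K := by
      have : E ^ (2 / k - 1) * x.2.2 ^ 2 ≥ 0 := by positivity
      have hG : P.rbScaledEnergy k E N x = E ^ (2 / k - 1) * ((x.2.1 ^ 2 + x.2.2 ^ 2) / 2) +
        (P.rbScaled k E).hamiltonian N x.1 := rfl
      rw [hK]; nlinarith [le_max_left M 0, le_max_right M 0]
    have hsq : (E ^ (1 / k - 1 / 2) * |x.2.1|) ^ 2 = E ^ (2 / k - 1) * x.2.1 ^ 2 := by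
      rw [mul_pow, sq_abs, ← Real.rpow_natCast, ← Real.rpow_mul hE0.le]; norm_num; left; congr 1; ring
    calc E ^ (1 / k - 1 / 2) * |x.2.1| = Real.sqrt ((E ^ (1 / k - 1 / 2) * |x.2.1|) ^ 2) :=
          (Real.sqrt_sq (by positivity)).symm
      _ ≤ Real.sqrt (2 * K) := Real.sqrt_le_sqrt (by rw [hsq]; exact h4)
  · -- `r_R`
    have h4 : E ^ (2 / k - 1) * x.2.2 ^ 2 ≤ 2 * K := by
      have : E ^ (2 / k - 1) * x.2.1 ^ 2 ≥ 0 := by positivity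
      have hG : P.rbScaledEnergy k E N x = E ^ (2 / k - 1) * ((x.2.1 ^ 2 + x.2.2 ^ 2) / 2) +
        (P.rbScaled k E).hamiltonian N x.1 := rfl
      rw [hK]; nlinarith [le_max_left M 0, le_max_right M 0]
    have hsq : (E ^ (1 / k - 1 / 2) * |x.2.2|) ^ 2 = E ^ (2 / k - 1) * x.2.2 ^ 2 := by
      rw [mul_pow, sq_abs, ← Real.rpow_natCast, ← Real.rpow_mul hE0.le]; norm_num; left; congr 1; ring
    calc E ^ (1 / k - 1 / 2) * |x.2.2| = Real.sqrt ((E ^ (1 / k - 1 / 2) * |x.2.2|) ^ 2) :=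
          (Real.sqrt_sq (by positivity)).symm
      _ ≤ Real.sqrt (2 * K) := Real.sqrt_le_sqrt (by rw [hsq]; exact h4)

end Apriori

/-! ### Norm bookkeeping on `RBPhaseSpace N` (sup norms) -/

section Norms

open Literature.MathematicalPhysics.KineticTheory

variable {N : ℕ}

/-- Component bounds give a norm bound on `RBPhaseSpace N`. [folklore] -/
theorem norm_rbPhaseSpace_le {v : RBPhaseSpace N} {C : ℝ} (hC : 0 ≤ C) (h11 : ∀ i, |v.1.1 i| ≤ C)
    (h12 : ∀ i, |v.1.2 i| ≤ C) (h21 : |v.2.1| ≤ C) (h22 : |v.2.2| ≤ C) : ‖v‖ ≤ C := by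
  rw [Prod.norm_def, max_le_iff, Prod.norm_def, max_le_iff, Prod.norm_def, max_le_iff,
    pi_norm_le_iff_of_nonneg hC, pi_norm_le_iff_of_nonneg hC]
  exact ⟨⟨fun i => (Real.norm_eq_abs _).le.trans (h11 i), fun i => (Real.norm_eq_abs _).le.trans (h12 i)⟩,
    (Real.norm_eq_abs _).le.trans h21, (Real.norm_eq_abs _).le.trans h22⟩

/-- Components are bounded by the norm on `RBPhaseSpace N`. [folklore] -/
theorem abs_le_norm_rbPhaseSpace (v : RBPhaseSpace N) :
    (∀ i, |v.1.1 i| ≤ ‖v‖) ∧ (∀ i, |v.1.2 i| ≤ ‖v‖) ∧ |v.2.1| ≤ ‖v‖ ∧ |v.2.2| ≤ ‖v‖ := by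
  refine ⟨fun i => ?_, fun i => ?_, ?_, ?_⟩
  · rw [← Real.norm_eq_abs]
    exact (norm_le_pi_norm (v.1.1) i).trans ((norm_fst_le v.1).trans (norm_fst_le v))
  · rw [← Real.norm_eq_abs]
    exact (norm_le_pi_norm (v.1.2) i).trans ((norm_snd_le v.1).trans (norm_fst_le v))
  · rw [← Real.norm_eq_abs]
    exact (norm_fst_le v.2).trans (norm_snd_le v)
  · rw [← Real.norm_eq_abs]
    exact (norm_snd_le v.2).trans (norm_snd_le v)

/-- **Two reservoir drifts with the same coupling and friction differ by little** when their
forces are uniformly close on the relevant ranges and their reservoir coefficients are close.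
[folklore] -/
theorem norm_rbDriftOf_sub_rbDriftOf_le {fU fV gU gV : ℝ → ℝ} {γ Λ c_p c_r c_p' c_r' : ℝ}
    {x : RBPhaseSpace N} {εF εc B R : ℝ} (hεF : 0 ≤ εF) (hεc : 0 ≤ εc) (hR : 0 ≤ R)
    (hq : ∀ i, |x.1.1 i| ≤ B) (hr₁ : |x.2.1| ≤ R) (hr₂ : |x.2.2| ≤ R)
    (hFU : ∀ y, |y| ≤ B → |fU y - gU y| ≤ εF) (hFV : ∀ y, |y| ≤ 2 * B → |fV y - gV y| ≤ εF)
    (hcp : |c_p - c_p'| ≤ εc) (hcr : |c_r - c_r'| ≤ εc) :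
    ‖rbDriftOf fU fV γ Λ N c_p c_r x - rbDriftOf gU gV γ Λ N c_p' c_r' x‖ ≤
      3 * εF + εc * (2 * |Λ| * R + |γ| * R) := by
  have hC : 0 ≤ 3 * εF + εc * (2 * |Λ| * R + |γ| * R) := by positivity
  have hΛ := abs_nonneg Λ
  have hγ := abs_nonneg γ
  have hbond : ∀ i j : Fin N, |fV (x.1.1 j - x.1.1 i) - gV (x.1.1 j - x.1.1 i)| ≤ εF := fun i j =>
    hFV _ ((abs_sub _ _).trans (by linarith [hq i, hq j]))
  set D₁ := rbDriftOf fU fV γ Λ N c_p c_r x with hD₁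
  set D₂ := rbDriftOf gU gV γ Λ N c_p' c_r' x with hD₂
  refine norm_rbPhaseSpace_le hC (fun i => ?_) (fun i => ?_) ?_ ?_
  · have e : (D₁ - D₂).1.1 i = 0 := by simp [hD₁, hD₂, rbDriftOf]
    rw [e, abs_zero]; exact hC
  · have hF : |rbForceOf fU fV N i x.1.1 - rbForceOf gU gV N i x.1.1| ≤ 3 * εF := by
      have h1 := hFU _ (hq i)
      have h2 : |(if h : 0 < i.val then fV (x.1.1 i - x.1.1 ⟨i.val - 1, by omega⟩) else 0) -
          (if h : 0 < i.val then gV (x.1.1 i - x.1.1 ⟨i.val - 1, by omega⟩) else 0)| ≤ εF := by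
        split_ifs with h
        · exact hbond _ _
        · simp [hεF]
      have h3 : |(if h : i.val + 1 < N then fV (x.1.1 ⟨i.val + 1, h⟩ - x.1.1 i) else 0) -
          (if h : i.val + 1 < N then gV (x.1.1 ⟨i.val + 1, h⟩ - x.1.1 i) else 0)| ≤ εF := by
        split_ifs with h
        · exact hbond _ _
        · simp [hεF]
      have he : rbForceOf fU fV N i x.1.1 - rbForceOf gU gV N i x.1.1 =
          (fU (x.1.1 i) - gU (x.1.1 i)) +
          ((if h : 0 < i.val then fV (x.1.1 i - x.1.1 ⟨i.val - 1, by omega⟩) else 0) -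
            (if h : 0 < i.val then gV (x.1.1 i - x.1.1 ⟨i.val - 1, by omega⟩) else 0)) -
          ((if h : i.val + 1 < N then fV (x.1.1 ⟨i.val + 1, h⟩ - x.1.1 i) else 0) -
            (if h : i.val + 1 < N then gV (x.1.1 ⟨i.val + 1, h⟩ - x.1.1 i) else 0)) := by
        simp only [rbForceOf]; ring
      rw [he]
      refine (abs_sub _ _).trans ?_
      have := abs_add_le (fU (x.1.1 i) - gU (x.1.1 i))
        ((if h : 0 < i.val then fV (x.1.1 i - x.1.1 ⟨i.val - 1, by omega⟩) else 0) -
          (if h : 0 < i.val then gV (x.1.1 i - x.1.1 ⟨i.val - 1, by omega⟩) else 0))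
      linarith
    have hAb : |(if i.val = 0 then x.2.1 else 0) + (if i.val = N - 1 then x.2.2 else 0)| ≤ 2 * R := by
      refine (abs_add_le _ _).trans ?_
      have e1 : |(if i.val = 0 then x.2.1 else 0)| ≤ R := by split_ifs <;> simp [hR, hr₁]
      have e2 : |(if i.val = N - 1 then x.2.2 else 0)| ≤ R := by split_ifs <;> simp [hR, hr₂]
      linarith
    have e : (D₁ - D₂).1.2 i = -(rbForceOf fU fV N i x.1.1 - rbForceOf gU gV N i x.1.1) -
        (c_p - c_p') * Λ * ((if i.val = 0 then x.2.1 else 0) + (if i.val = N - 1 then x.2.2 else 0)) := by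
      simp only [hD₁, hD₂, rbDriftOf, Prod.mk_sub_mk, Pi.sub_apply]; ring
    rw [e]
    refine (abs_sub _ _).trans ?_
    rw [abs_neg, abs_mul, abs_mul]
    have : |c_p - c_p'| * |Λ| * |(if i.val = 0 then x.2.1 else 0) + (if i.val = N - 1 then x.2.2 else 0)| ≤
        εc * |Λ| * (2 * R) :=
      mul_le_mul (mul_le_mul_of_nonneg_right hcp hΛ) hAb (abs_nonneg _) (by positivity)
    nlinarith [mul_nonneg (mul_nonneg hεc hΛ) hR, mul_nonneg (mul_nonneg hεc hγ) hR]
  · have e : (D₁ - D₂).2.1 = -((c_r - c_r') * γ * x.2.1) := by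
      simp only [hD₁, hD₂, rbDriftOf, Prod.mk_sub_mk]; ring
    rw [e, abs_neg, abs_mul, abs_mul]
    have : |c_r - c_r'| * |γ| * |x.2.1| ≤ εc * |γ| * R :=
      mul_le_mul (mul_le_mul_of_nonneg_right hcr hγ) hr₁ (abs_nonneg _) (by positivity)
    nlinarith [mul_nonneg (mul_nonneg hεc hΛ) hR, mul_nonneg (mul_nonneg hεc hγ) hR]
  · have e : (D₁ - D₂).2.2 = -((c_r - c_r') * γ * x.2.2) := by
      simp only [hD₁, hD₂, rbDriftOf, Prod.mk_sub_mk]; ring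
    rw [e, abs_neg, abs_mul, abs_mul]
    have : |c_r - c_r'| * |γ| * |x.2.2| ≤ εc * |γ| * R :=
      mul_le_mul (mul_le_mul_of_nonneg_right hcr hγ) hr₂ (abs_nonneg _) (by positivity)
    nlinarith [mul_nonneg (mul_nonneg hεc hΛ) hR, mul_nonneg (mul_nonneg hεc hγ) hR]

end Norms

/-! ### Uniform bound of the rescaled drift along bounded-energy sets -/

section DriftBound

open Literature.Analysis.ODE Literature.MathematicalPhysics.KineticTheory

variable {N : ℕ} {P : OscillatorChain} {k : ℝ} (hU : RBGrowth P.U k) (hV : RBGrowth P.V k)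
  (hk : 2 ≤ k) (Λ : ℝ) (N)
include hU hV hk

/-- For `E ≥ 1` and `k ≥ 2`, `E^{1/k-1/2} ≤ 1`. [folklore] -/
theorem rpow_inv_sub_half_le_one {E : ℝ} (hE : 1 ≤ E) : E ^ (1 / k - 1 / 2) ≤ 1 := by
  have := hU; have := hV
  refine Real.rpow_le_one_of_one_le_of_nonpos hE ?_
  have h2 : 1 / k ≤ 1 / 2 := by
    rw [div_le_div_iff₀ (by linarith) (by norm_num)]; linarith
  linarith

/-- **A-priori bounds and a uniform bound of the rescaled drift (20)** on `{G̃_E ≤ M}`, `E ≥ 1`: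
positions, momenta, `E^{1/k-1/2}|r̃|` and `‖Ỹ_E‖` are bounded by constants depending only on `M`
(and the data). [cite: ReyBelletThomas2002, §3.1 eqs. (19)–(20)] -/
theorem scaled_drift_bound (M : ℝ) : ∃ B C_p R M₁ : ℝ, 0 ≤ B ∧ 0 ≤ C_p ∧ 0 ≤ R ∧ 0 ≤ M₁ ∧
    ∀ E : ℝ, 1 ≤ E → ∀ x : RBPhaseSpace N, P.rbScaledEnergy k E N x ≤ M →
      (∀ i, |x.1.1 i| ≤ B) ∧ (∀ i, |x.1.2 i| ≤ C_p) ∧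
      E ^ (1 / k - 1 / 2) * |x.2.1| ≤ R ∧ E ^ (1 / k - 1 / 2) * |x.2.2| ≤ R ∧
      ‖(P.rbScaled k E).rbDriftGen Λ N (E ^ (2 / k - 1)) (E ^ (1 / k - 1 / 2)) x‖ ≤ M₁ := by
  obtain ⟨B, Cp, Cr, hB, hCp, hCr, hapr⟩ := scaled_apriori hU hV hk N M
  have hk1 : 1 ≤ k := by linarith
  obtain ⟨MU, hMU, hFU⟩ := hU.exists_forall_abs_deriv_scaledPot_le hk1 B
  obtain ⟨MV, hMV, hFV⟩ := hV.exists_forall_abs_deriv_scaledPot_le hk1 (2 * B)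
  have hΛ := abs_nonneg Λ
  have hγ := abs_nonneg P.γ
  have hN0 : (0 : ℝ) ≤ N := Nat.cast_nonneg N
  set M₁ : ℝ := Cp + (MU + 2 * MV + 2 * |Λ| * Cr) + (|P.γ| * Cr + |Λ| * (N * Cp)) with hM₁
  have hx1 : 0 ≤ MU + 2 * MV + 2 * |Λ| * Cr := by positivity
  have hx2 : 0 ≤ |P.γ| * Cr + |Λ| * (N * Cp) := by positivity
  have hM₁0 : 0 ≤ M₁ := by positivity
  have hM₁a : Cp ≤ M₁ := by rw [hM₁]; linarith
  have hM₁b : MU + 2 * MV + |Λ| * (2 * Cr) ≤ M₁ := by rw [hM₁]; linarith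
  have hM₁c : |P.γ| * Cr + |Λ| * (N * Cp) ≤ M₁ := by rw [hM₁]; linarith
  refine ⟨B, Cp, Cr, M₁, hB, hCp, hCr, hM₁0, fun E hE x hx => ?_⟩
  obtain ⟨hq, hp, hr₁, hr₂⟩ := hapr E hE x hx
  refine ⟨hq, hp, hr₁, hr₂, ?_⟩
  have hE0 : 0 < E := by linarith
  have hexp : E ^ (1 / k - 1 / 2) ≤ 1 := rpow_inv_sub_half_le_one hU hV hk hE
  have hcp0 : 0 ≤ E ^ (2 / k - 1) := Real.rpow_nonneg hE0.le _
  have hcr0 : 0 ≤ E ^ (1 / k - 1 / 2) := Real.rpow_nonneg hE0.le _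
  have hcp : E ^ (2 / k - 1) = E ^ (1 / k - 1 / 2) * E ^ (1 / k - 1 / 2) := by
    rw [← Real.rpow_add hE0]; congr 1; ring
  have hcpr₁ : E ^ (2 / k - 1) * |x.2.1| ≤ Cr := by
    rw [hcp, mul_assoc]
    exact (mul_le_of_le_one_left (by positivity) hexp).trans hr₁
  have hcpr₂ : E ^ (2 / k - 1) * |x.2.2| ≤ Cr := by
    rw [hcp, mul_assoc]
    exact (mul_le_of_le_one_left (by positivity) hexp).trans hr₂
  have hbd : ∀ i j : Fin N, |deriv (RBGrowth.scaledPot P.V k E) (x.1.1 j - x.1.1 i)| ≤ MV :=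
    fun i j => hFV E hE _ ((abs_sub _ _).trans (by linarith [hq i, hq j]))
  have hsum : ∀ (c : Fin N → Prop) [DecidablePred c],
      |∑ i : Fin N, (if c i then x.1.2 i else 0)| ≤ N * Cp := by
    intro c _
    refine (Finset.abs_sum_le_sum_abs _ _).trans ?_
    have : ∀ i ∈ (Finset.univ : Finset (Fin N)), |(if c i then x.1.2 i else 0)| ≤ Cp := fun i _ => by
      split_ifs
      · exact hp i
      · simp [hCp]
    refine (Finset.sum_le_sum this).trans ?_
    simp
  refine norm_rbPhaseSpace_le hM₁0 (fun i => ?_) (fun i => ?_) ?_ ?_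
  · -- `q̇ = p`
    simp only [OscillatorChain.rbDriftGen]
    exact (hp i).trans hM₁a
  · -- `ṗ`
    simp only [OscillatorChain.rbDriftGen]
    have hd : |(P.rbScaled k E).dPotential N i x.1.1| ≤ MU + 2 * MV := by
      rw [OscillatorChain.dPotential_eq_closed]
      simp only [OscillatorChain.rbScaled_U, OscillatorChain.rbScaled_V]
      have h1 := hFU E hE _ (hq i)
      have h2 : |(if h : 0 < i.val then deriv (RBGrowth.scaledPot P.V k E) (x.1.1 i - x.1.1 ⟨i.val - 1, by omega⟩) else 0)| ≤ MV := by
        split_ifs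
        · exact hbd _ _
        · simp [hMV]
      have h3 : |(if h : i.val + 1 < N then deriv (RBGrowth.scaledPot P.V k E) (x.1.1 ⟨i.val + 1, h⟩ - x.1.1 i) else 0)| ≤ MV := by
        split_ifs
        · exact hbd _ _
        · simp [hMV]
      refine (abs_sub _ _).trans ?_
      have := abs_add_le (deriv (RBGrowth.scaledPot P.U k E) (x.1.1 i))
        (if h : 0 < i.val then deriv (RBGrowth.scaledPot P.V k E) (x.1.1 i - x.1.1 ⟨i.val - 1, by omega⟩) else 0)
      linarith
    have hA : E ^ (2 / k - 1) * |(if i.val = 0 then x.2.1 else 0) + (if i.val = N - 1 then x.2.2 else 0)| ≤ 2 * Cr := by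
      refine (mul_le_mul_of_nonneg_left (abs_add_le _ _) hcp0).trans ?_
      rw [mul_add]
      have e1 : E ^ (2 / k - 1) * |(if i.val = 0 then x.2.1 else 0)| ≤ Cr := by
        split_ifs
        · exact hcpr₁
        · simp [hCr]
      have e2 : E ^ (2 / k - 1) * |(if i.val = N - 1 then x.2.2 else 0)| ≤ Cr := by
        split_ifs
        · exact hcpr₂
        · simp [hCr]
      linarith
    refine (abs_sub _ _).trans ?_
    rw [abs_neg, abs_mul, abs_mul, abs_of_nonneg hcp0]
    have : E ^ (2 / k - 1) * |Λ| * |(if i.val = 0 then x.2.1 else 0) + (if i.val = N - 1 then x.2.2 else 0)| ≤ |Λ| * (2 * Cr) := by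
      rw [mul_comm (E ^ (2 / k - 1)) |Λ|, mul_assoc]
      exact mul_le_mul_of_nonneg_left hA hΛ
    linarith
  · -- `ṙ_L`
    simp only [OscillatorChain.rbDriftGen, OscillatorChain.rbScaled_γ]
    refine (abs_add_le _ _).trans ?_
    rw [abs_neg, abs_mul, abs_mul, abs_of_nonneg hcr0, abs_mul]
    have h1 : E ^ (1 / k - 1 / 2) * |P.γ| * |x.2.1| ≤ |P.γ| * Cr := by
      rw [mul_comm (E ^ (1 / k - 1 / 2)) |P.γ|, mul_assoc]
      exact mul_le_mul_of_nonneg_left hr₁ hγ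
    have h2 : |Λ| * |∑ i : Fin N, (if i.val = 0 then x.1.2 i else 0)| ≤ |Λ| * (N * Cp) :=
      mul_le_mul_of_nonneg_left (hsum _) hΛ
    linarith
  · -- `ṙ_R`
    simp only [OscillatorChain.rbDriftGen, OscillatorChain.rbScaled_γ]
    refine (abs_add_le _ _).trans ?_
    rw [abs_neg, abs_mul, abs_mul, abs_of_nonneg hcr0, abs_mul]
    have h1 : E ^ (1 / k - 1 / 2) * |P.γ| * |x.2.2| ≤ |P.γ| * Cr := by
      rw [mul_comm (E ^ (1 / k - 1 / 2)) |P.γ|, mul_assoc]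
      exact mul_le_mul_of_nonneg_left hr₂ hγ
    have h2 : |Λ| * |∑ i : Fin N, (if i.val = N - 1 then x.1.2 i else 0)| ≤ |Λ| * (N * Cp) :=
      mul_le_mul_of_nonneg_left (hsum _) hΛ
    linarith

/-- The rescaled drift (20) is continuous. [folklore] -/
theorem continuous_rbDriftGen_rbScaled {E : ℝ} (hE : 0 < E) (c_p c_r : ℝ) :
    Continuous ((P.rbScaled k E).rbDriftGen Λ N c_p c_r) := by
  have := hk
  rw [OscillatorChain.rbDriftGen_eq_rbDriftOf]
  simp only [OscillatorChain.rbScaled_U, OscillatorChain.rbScaled_V, OscillatorChain.rbScaled_γ]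
  have hdU : deriv (RBGrowth.scaledPot P.U k E) = fun y => E ^ (1 / k - 1) * deriv P.U (E ^ (1 / k) * y) :=
    funext fun y => hU.deriv_scaledPot hE y
  have hdV : deriv (RBGrowth.scaledPot P.V k E) = fun y => E ^ (1 / k - 1) * deriv P.V (E ^ (1 / k) * y) :=
    funext fun y => hV.deriv_scaledPot hE y
  refine continuous_rbDriftOf ?_ ?_ _ _ _ _ _
  · rw [hdU]; exact continuous_const.mul (hU.continuous_deriv.comp (continuous_const.mul continuous_id))
  · rw [hdV]; exact continuous_const.mul (hV.continuous_deriv.comp (continuous_const.mul continuous_id))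

end DriftBound

/-! ### The compactness–contradiction argument (Theorem 3.3's proof, quantitative form) -/

section Core

open Literature.Analysis.ODE Literature.MathematicalPhysics.KineticTheory Metric

variable {N : ℕ}

/-- `ε`-characterisation of convergence of a sequence in a normed group. [folklore] -/
theorem tendsto_of_forall_eventually_norm_sub_le {F : Type*} [NormedAddCommGroup F] {u : ℕ → F} {a : F}
    (h : ∀ ε > 0, ∀ᶠ n in atTop, ‖u n - a‖ ≤ ε) : Tendsto u atTop (𝓝 a) := by
  rw [Metric.tendsto_atTop]
  intro ε hε
  obtain ⟨N₀, hN₀⟩ := (h (ε / 2) (by positivity)).exists_forall_of_atTop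
  exact ⟨N₀, fun n hn => by rw [dist_eq_norm]; exact (hN₀ n hn).trans_lt (by linarith)⟩

/-- `ε`-characterisation of convergence of a real sequence (absolute values). [folklore] -/
theorem eventually_abs_sub_le_of_tendsto {u : ℕ → ℝ} {a : ℝ} (h : Tendsto u atTop (𝓝 a)) {ε : ℝ}
    (hε : 0 < ε) : ∀ᶠ n in atTop, |u n - a| ≤ ε := by
  obtain ⟨N₀, hN₀⟩ := Metric.tendsto_atTop.1 h ε hε
  exact eventually_atTop.2 ⟨N₀, fun n hn => by have := hN₀ n hn; rw [Real.dist_eq] at this; exact this.le⟩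

/-- The norm of a pure reservoir vector `(0, e)` is `‖e‖`. [folklore] -/
theorem norm_zero_prod_rb (e : ℝ × ℝ) : ‖((0 : PhaseSpace N), e)‖ = ‖e‖ := by
  simp [Prod.norm_def]

variable {P : OscillatorChain} {k : ℝ} (hU : RBGrowth P.U k) (hV : RBGrowth P.V k)
  (hk : 2 ≤ k) {Λ : ℝ} (hΛ : Λ ≠ 0) (hN : 0 < N) {Λ₀ : ℝ} (hΛ₀ : 0 < Λ₀)
include hU hV hk

/-- **Small points have small rescaled energy, uniformly in `E ≥ 1`**:
`G̃_E(z) ≤ ρ² + N(ρ²/2 + C_U(1/E + ρ^k)) + N² C_V (1/E + (2ρ)^k)` for `‖z‖ ≤ ρ`.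
[cite: ReyBelletThomas2002, §3.1 (after eq. (19))] -/
theorem rbScaledEnergy_le_of_norm_le : ∃ C_U C_V : ℝ, 0 ≤ C_U ∧ 0 ≤ C_V ∧ ∀ E : ℝ, 1 ≤ E →
    ∀ (z : RBPhaseSpace N) (ρ : ℝ), ‖z‖ ≤ ρ →
      P.rbScaledEnergy k E N z ≤ ρ ^ 2 + N * (ρ ^ 2 / 2 + C_U * (1 / E + ρ ^ k)) +
        N * (N * (C_V * (1 / E + (2 * ρ) ^ k))) := by
  have hk0 : 0 < k := by linarith
  obtain ⟨CU, hCU, hUle⟩ := hU.scaledPot_le hk0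
  obtain ⟨CV, hCV, hVle⟩ := hV.scaledPot_le hk0
  refine ⟨CU, CV, hCU, hCV, fun E hE z ρ hz => ?_⟩
  have hE0 : 0 < E := by linarith
  have hρ : 0 ≤ ρ := (norm_nonneg _).trans hz
  obtain ⟨hq, hp, hr₁, hr₂⟩ := abs_le_norm_rbPhaseSpace z
  have hq' : ∀ i, |z.1.1 i| ≤ ρ := fun i => (hq i).trans hz
  have hp' : ∀ i, |z.1.2 i| ≤ ρ := fun i => (hp i).trans hz
  have hexp : E ^ (2 / k - 1) ≤ 1 := Real.rpow_le_one_of_one_le_of_nonpos hE (by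
    have : 2 / k ≤ 1 := by rw [div_le_one (by linarith)]; linarith
    linarith)
  -- reservoir term
  have h1 : E ^ (2 / k - 1) * ((z.2.1 ^ 2 + z.2.2 ^ 2) / 2) ≤ ρ ^ 2 := by
    have ha : z.2.1 ^ 2 ≤ ρ ^ 2 := by
      rw [← sq_abs]; exact pow_le_pow_left₀ (abs_nonneg _) (hr₁.trans hz) 2
    have hb : z.2.2 ^ 2 ≤ ρ ^ 2 := by
      rw [← sq_abs]; exact pow_le_pow_left₀ (abs_nonneg _) (hr₂.trans hz) 2
    have hs : 0 ≤ (z.2.1 ^ 2 + z.2.2 ^ 2) / 2 := by positivity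
    calc E ^ (2 / k - 1) * ((z.2.1 ^ 2 + z.2.2 ^ 2) / 2) ≤ 1 * ((z.2.1 ^ 2 + z.2.2 ^ 2) / 2) :=
          mul_le_mul_of_nonneg_right hexp hs
      _ ≤ ρ ^ 2 := by linarith
  -- pinning terms
  have h2 : ∑ i : Fin N, (z.1.2 i ^ 2 / 2 + (P.rbScaled k E).U (z.1.1 i)) ≤
      N * (ρ ^ 2 / 2 + CU * (1 / E + ρ ^ k)) := by
    have : ∀ i ∈ (Finset.univ : Finset (Fin N)), z.1.2 i ^ 2 / 2 + (P.rbScaled k E).U (z.1.1 i) ≤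
        ρ ^ 2 / 2 + CU * (1 / E + ρ ^ k) := fun i _ => by
      have ha : z.1.2 i ^ 2 ≤ ρ ^ 2 := by
        rw [← sq_abs]; exact pow_le_pow_left₀ (abs_nonneg _) (hp' i) 2
      have hb : (P.rbScaled k E).U (z.1.1 i) ≤ CU * (1 / E + ρ ^ k) := by
        simp only [OscillatorChain.rbScaled_U]
        refine (hUle E hE0 _).trans (mul_le_mul_of_nonneg_left ?_ hCU)
        have := Real.rpow_le_rpow (abs_nonneg _) (hq' i) hk0.le
        linarith
      linarith
    refine (Finset.sum_le_sum this).trans ?_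
    rw [Finset.sum_const, Finset.card_univ, Fintype.card_fin, nsmul_eq_mul]
  -- interaction terms
  have h3 : ∑ i : Fin N, ∑ j : Fin N, (if j.val = i.val + 1 then (P.rbScaled k E).V (z.1.1 j - z.1.1 i) else 0) ≤
      N * (N * (CV * (1 / E + (2 * ρ) ^ k))) := by
    have hb0 : 0 ≤ CV * (1 / E + (2 * ρ) ^ k) := by positivity
    have : ∀ i ∈ (Finset.univ : Finset (Fin N)), ∑ j : Fin N,
        (if j.val = i.val + 1 then (P.rbScaled k E).V (z.1.1 j - z.1.1 i) else 0) ≤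
        N * (CV * (1 / E + (2 * ρ) ^ k)) := fun i _ => by
      have : ∀ j ∈ (Finset.univ : Finset (Fin N)),
          (if j.val = i.val + 1 then (P.rbScaled k E).V (z.1.1 j - z.1.1 i) else 0) ≤
          CV * (1 / E + (2 * ρ) ^ k) := fun j _ => by
        split_ifs
        · simp only [OscillatorChain.rbScaled_V]
          refine (hVle E hE0 _).trans (mul_le_mul_of_nonneg_left ?_ hCV)
          have hd : |z.1.1 j - z.1.1 i| ≤ 2 * ρ := (abs_sub _ _).trans (by linarith [hq' i, hq' j])
          have := Real.rpow_le_rpow (abs_nonneg _) hd hk0.le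
          linarith
        · exact hb0
      refine (Finset.sum_le_sum this).trans ?_
      rw [Finset.sum_const, Finset.card_univ, Fintype.card_fin, nsmul_eq_mul]
    refine (Finset.sum_le_sum this).trans ?_
    rw [Finset.sum_const, Finset.card_univ, Fintype.card_fin, nsmul_eq_mul]
  unfold OscillatorChain.rbScaledEnergy OscillatorChain.hamiltonian
  linarith

include hΛ hN hΛ₀

/-- **The compactness core of Theorem 3.3 (sequential form).** Along any sequence of energies
`E_n → ∞`, rescaled controlled trajectories `x̃_n = x̃_n(0) + (0, η̃_n) + ∫ Ỹ_{E_n}(x̃_n)` on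
`[0, Λ₀]` with rescaled energy `≥ 1/2` initially and `≤ M` throughout, bounded initial reservoir
variables and controls `η̃_n → 0` uniformly CANNOT have dissipation `∫₀^{Λ₀} |r̃_n|² → 0`:
an equicontinuous subsequence of the drift-driven parts converges (Arzelà–Ascoli) to a solution of
the limiting system (21) with vanishing dissipation, whose initial point must be the origin
(`limit_initial_eq_zero`), contradicting rescaled energy `≥ 1/2`.
[cite: ReyBelletThomas2002, Thm 3.3 & Cor 3.6 (proof)] -/
theorem scaled_core_seq {M R₀ : ℝ} {Es δ : ℕ → ℝ} {x : ℕ → ℝ → RBPhaseSpace N} {η : ℕ → ℝ → ℝ × ℝ}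
    (hE1 : ∀ n, 1 ≤ Es n) (hE : Tendsto Es atTop atTop) (hδ : Tendsto δ atTop (𝓝 0))
    (hδ1 : ∀ n, δ n ≤ 1) (hxc : ∀ n, Continuous (x n))
    (hsol : ∀ n, IsIntegralSolutionOn
      ((P.rbScaled k (Es n)).rbDriftGen Λ N (Es n ^ (2 / k - 1)) (Es n ^ (1 / k - 1 / 2)))
      (fun s => x n 0 + ((0 : PhaseSpace N), η n s)) (x n) Λ₀)
    (hG0 : ∀ n, 1 / 2 ≤ P.rbScaledEnergy k (Es n) N (x n 0))
    (hr0 : ∀ n, |(x n 0).2.1| ≤ R₀ ∧ |(x n 0).2.2| ≤ R₀)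
    (hηb : ∀ n, ∀ s ∈ Icc 0 Λ₀, ‖η n s‖ ≤ δ n)
    (hGM : ∀ n, ∀ s ∈ Icc 0 Λ₀, P.rbScaledEnergy k (Es n) N (x n s) ≤ M) :
    ¬ Tendsto (fun n => ∫ s in (0 : ℝ)..Λ₀, ((x n s).2.1 ^ 2 + (x n s).2.2 ^ 2)) atTop (𝓝 0) := by
  intro hdiss
  have hk0 : 0 < k := by linarith
  -- constants
  obtain ⟨B, Cp, Cr, M₁, hB, hCp, hCr, hM₁, hbd⟩ := scaled_drift_bound hU hV hk Λ N M
  have hR₀ : 0 ≤ R₀ := (abs_nonneg _).trans (hr0 0).1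
  have hE0 : ∀ n, 0 < Es n := fun n => by linarith [hE1 n]
  set Y : ℕ → RBPhaseSpace N → RBPhaseSpace N := fun n =>
    (P.rbScaled k (Es n)).rbDriftGen Λ N (Es n ^ (2 / k - 1)) (Es n ^ (1 / k - 1 / 2)) with hY
  have hYc : ∀ n, Continuous (Y n) := fun n =>
    continuous_rbDriftGen_rbScaled hU hV hk Λ N (hE0 n) _ _
  have hYxc : ∀ n, Continuous fun s => Y n (x n s) := fun n => (hYc n).comp (hxc n)
  have hYb : ∀ n, ∀ s ∈ Icc 0 Λ₀, ‖Y n (x n s)‖ ≤ M₁ := fun n s hs =>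
    (hbd (Es n) (hE1 n) (x n s) (hGM n s hs)).2.2.2.2
  have hxb : ∀ n, ∀ s ∈ Icc 0 Λ₀, (∀ i, |(x n s).1.1 i| ≤ B) ∧ (∀ i, |(x n s).1.2 i| ≤ Cp) :=
    fun n s hs => ⟨(hbd (Es n) (hE1 n) (x n s) (hGM n s hs)).1,
      (hbd (Es n) (hE1 n) (x n s) (hGM n s hs)).2.1⟩
  have h0m : (0 : ℝ) ∈ Icc 0 Λ₀ := ⟨le_rfl, hΛ₀.le⟩
  have hη1 : ∀ n, ∀ s ∈ Icc 0 Λ₀, |(η n s).1| ≤ δ n ∧ |(η n s).2| ≤ δ n := fun n s hs =>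
    ⟨((Real.norm_eq_abs _).symm.le.trans (norm_fst_le (η n s))).trans (hηb n s hs),
      ((Real.norm_eq_abs _).symm.le.trans (norm_snd_le (η n s))).trans (hηb n s hs)⟩
  -- the drift-driven part `y_n = x_n - (0, η_n)` and its integral equation
  set y : ℕ → ℝ → RBPhaseSpace N := fun n s => x n s - ((0 : PhaseSpace N), η n s) with hy
  have hyIE : ∀ n, ∀ s ∈ Icc 0 Λ₀, y n s = x n 0 + ∫ u in (0 : ℝ)..s, Y n (x n u) := by
    intro n s hs
    have h' : x n s = x n 0 + ((0 : PhaseSpace N), η n s) + ∫ u in (0:ℝ)..s, Y n (x n u) :=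
      hsol n s hs
    simp only [hy]
    rw [h']; abel
  have hxy : ∀ n s, x n s = y n s + ((0 : PhaseSpace N), η n s) := fun n s => by
    simp only [hy]; abel
  -- integral bound
  have hint : ∀ n, ∀ s ∈ Icc 0 Λ₀, ∀ t ∈ Icc 0 Λ₀,
      ‖(∫ u in (0:ℝ)..t, Y n (x n u)) - ∫ u in (0:ℝ)..s, Y n (x n u)‖ ≤ M₁ * |t - s| := by
    intro n s hs t ht
    rw [intervalIntegral.integral_interval_sub_left ((hYxc n).intervalIntegrable _ _)
      ((hYxc n).intervalIntegrable _ _)]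
    refine intervalIntegral.norm_integral_le_of_norm_le_const fun u hu => hYb n u ?_
    rcases le_total s t with hst | hst
    · rw [Set.uIoc_of_le hst] at hu; exact ⟨hs.1.trans hu.1.le, hu.2.trans ht.2⟩
    · rw [Set.uIoc_of_ge hst] at hu; exact ⟨ht.1.trans hu.1.le, hu.2.trans hs.2⟩
  have hint0 : ∀ n, ∀ s ∈ Icc 0 Λ₀, ‖∫ u in (0:ℝ)..s, Y n (x n u)‖ ≤ M₁ * Λ₀ := by
    intro n s hs
    have hI := hint n 0 h0m s hs
    rw [intervalIntegral.integral_same, sub_zero, sub_zero, abs_of_nonneg hs.1] at hI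
    exact hI.trans (mul_le_mul_of_nonneg_left hs.2 hM₁)
  -- uniform bound of the reservoir variables
  set R₁ : ℝ := R₀ + 1 + M₁ * Λ₀ with hR₁
  have hR₁0 : 0 ≤ R₁ := by rw [hR₁]; positivity
  have hrb : ∀ n, ∀ s ∈ Icc 0 Λ₀, |(x n s).2.1| ≤ R₁ ∧ |(x n s).2.2| ≤ R₁ := by
    intro n s hs
    have h1 := hyIE n s hs
    have hIΛ := hint0 n s hs
    obtain ⟨-, -, e1, e2⟩ := abs_le_norm_rbPhaseSpace (∫ u in (0:ℝ)..s, Y n (x n u))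
    obtain ⟨hη1s, hη2s⟩ := hη1 n s hs
    have c1 : (x n s).2.1 = (x n 0).2.1 + (η n s).1 + (∫ u in (0:ℝ)..s, Y n (x n u)).2.1 := by
      have := congrArg (fun v : RBPhaseSpace N => v.2.1) h1
      simp only [hy, Prod.snd_sub, Prod.fst_sub, Prod.snd_add, Prod.fst_add] at this
      linarith
    have c2 : (x n s).2.2 = (x n 0).2.2 + (η n s).2 + (∫ u in (0:ℝ)..s, Y n (x n u)).2.2 := by
      have := congrArg (fun v : RBPhaseSpace N => v.2.2) h1
      simp only [hy, Prod.snd_sub, Prod.snd_add] at this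
      linarith
    constructor
    · rw [c1]
      refine (abs_add_le _ _).trans ((add_le_add (abs_add_le _ _) le_rfl).trans ?_)
      rw [hR₁]; linarith [(hr0 n).1, hδ1 n]
    · rw [c2]
      refine (abs_add_le _ _).trans ((add_le_add (abs_add_le _ _) le_rfl).trans ?_)
      rw [hR₁]; linarith [(hr0 n).2, hδ1 n]
  -- uniform bound of `y_n` on `[0, Λ₀]`
  set Rb : ℝ := B + Cp + R₁ + 1 with hRb
  have hRb0 : 0 ≤ Rb := by rw [hRb]; positivity
  have hybd : ∀ n, ∀ s ∈ Icc 0 Λ₀, ‖y n s‖ ≤ Rb := by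
    intro n s hs
    obtain ⟨hq, hp⟩ := hxb n s hs
    obtain ⟨h1, h2⟩ := hrb n s hs
    obtain ⟨hη1s, hη2s⟩ := hη1 n s hs
    refine norm_rbPhaseSpace_le hRb0 (fun i => ?_) (fun i => ?_) ?_ ?_
    · have e : (y n s).1.1 i = (x n s).1.1 i := by simp [hy]
      rw [e]; exact (hq i).trans (by rw [hRb]; linarith)
    · have e : (y n s).1.2 i = (x n s).1.2 i := by simp [hy]
      rw [e]; exact (hp i).trans (by rw [hRb]; linarith)
    · have e : (y n s).2.1 = (x n s).2.1 - (η n s).1 := by simp [hy]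
      rw [e]; refine (abs_sub _ _).trans ?_; rw [hRb]; linarith [hδ1 n]
    · have e : (y n s).2.2 = (x n s).2.2 - (η n s).2 := by simp [hy]
      rw [e]; refine (abs_sub _ _).trans ?_; rw [hRb]; linarith [hδ1 n]
  have hxbd : ∀ n, ∀ s ∈ Icc 0 Λ₀, ‖x n s‖ ≤ Rb + 1 := by
    intro n s hs
    rw [hxy n s]
    refine (norm_add_le _ _).trans ?_
    rw [norm_zero_prod_rb]
    linarith [hybd n s hs, hηb n s hs, hδ1 n]
  -- equi-Lipschitz
  have hylip : ∀ n, LipschitzOnWith ⟨M₁, hM₁⟩ (y n) (Icc 0 Λ₀) := by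
    intro n
    refine LipschitzOnWith.of_dist_le_mul fun s hs t ht => ?_
    rw [dist_eq_norm, Real.dist_eq, hyIE n s hs, hyIE n t ht, add_sub_add_left_eq_sub]
    exact hint n t ht s hs
  -- Arzelà–Ascoli extraction
  obtain ⟨g, φ, hφ, hgc, -, hconv⟩ := exists_subseq_tendsto_of_lipschitz hΛ₀.le hybd hylip
  have hφt : Tendsto φ atTop atTop := hφ.tendsto_atTop
  have hEφ : Tendsto (fun n => Es (φ n)) atTop atTop := hE.comp hφt
  -- uniform convergence `x_{φ n} → g` on `[0, Λ₀]`
  have HX : ∀ ε > 0, ∀ᶠ n in atTop, ∀ u ∈ Icc 0 Λ₀, ‖x (φ n) u - g u‖ ≤ ε := by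
    intro ε hε
    have h2 : ∀ᶠ n in atTop, δ (φ n) < ε / 2 :=
      (hδ.comp hφt).eventually_lt_const (by positivity)
    filter_upwards [hconv (ε / 2) (by positivity), h2] with n h1n h2n u hu
    have e : x (φ n) u - g u = (y (φ n) u - g u) + ((0 : PhaseSpace N), η (φ n) u) := by
      rw [hxy (φ n) u]; abel
    rw [e]
    refine (norm_add_le _ _).trans ?_
    rw [norm_zero_prod_rb]
    linarith [h1n u hu, hηb (φ n) u hu]
  have HXpt : ∀ u ∈ Icc 0 Λ₀, Tendsto (fun n => x (φ n) u) atTop (𝓝 (g u)) := fun u hu =>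
    tendsto_of_forall_eventually_norm_sub_le fun ε hε => (HX ε hε).mono fun n hn => hn u hu
  -- everything lives in a compact box
  set K : Set (RBPhaseSpace N) := closedBall 0 (Rb + 1) with hK
  have hKc : IsCompact K := isCompact_closedBall _ _
  have hxK : ∀ n, ∀ u ∈ Icc 0 Λ₀, x n u ∈ K := fun n u hu => by
    rw [hK, mem_closedBall, dist_zero_right]; exact hxbd n u hu
  have hgK : ∀ u ∈ Icc 0 Λ₀, g u ∈ K := fun u hu => by
    obtain ⟨n, hn⟩ := (hconv 1 one_pos).exists
    rw [hK, mem_closedBall, dist_zero_right]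
    have := norm_sub_le_norm_sub_add_norm_sub (g u) (y (φ n) u) 0
    simp only [sub_zero] at this
    rw [norm_sub_rev] at this
    linarith [hn u hu, hybd (φ n) u hu]
  have hgb : ∀ u ∈ Icc 0 Λ₀, ‖g u‖ ≤ Rb + 1 := fun u hu => by
    have := hgK u hu; rwa [hK, mem_closedBall, dist_zero_right] at this
  -- the limiting coefficients `c = lim E^{2/k-1} = lim E^{1/k-1/2}` (`1` if `k = 2`, else `0`)
  set c : ℝ := if k = 2 then 1 else 0 with hc
  have hcp : Tendsto (fun n => Es (φ n) ^ (2 / k - 1)) atTop (𝓝 c) := by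
    by_cases hk2 : k = 2
    · have : (fun n => Es (φ n) ^ (2 / k - 1)) = fun _ => (1 : ℝ) := by
        funext n; rw [hk2]; norm_num
      rw [this, hc, if_pos hk2]; exact tendsto_const_nhds
    · have hk' : 2 < k := lt_of_le_of_ne hk (Ne.symm hk2)
      simp only [hc, if_neg hk2]
      have hpos : 0 < 1 - 2 / k := by
        rw [sub_pos, div_lt_one (by linarith)]; exact hk'
      have h := (tendsto_rpow_neg_atTop hpos).comp hEφ
      have : (fun n => Es (φ n) ^ (2 / k - 1)) = (fun x : ℝ => x ^ (-(1 - 2 / k))) ∘ fun n => Es (φ n) := by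
        funext n; simp only [Function.comp]; congr 1; ring
      rw [this]; exact h
  have hcr : Tendsto (fun n => Es (φ n) ^ (1 / k - 1 / 2)) atTop (𝓝 c) := by
    by_cases hk2 : k = 2
    · have : (fun n => Es (φ n) ^ (1 / k - 1 / 2)) = fun _ => (1 : ℝ) := by
        funext n; rw [hk2]; norm_num
      rw [this, hc, if_pos hk2]; exact tendsto_const_nhds
    · have hk' : 2 < k := lt_of_le_of_ne hk (Ne.symm hk2)
      simp only [hc, if_neg hk2]
      have hpos : 0 < 1 / 2 - 1 / k := by
        rw [sub_pos]; exact one_div_lt_one_div_of_lt (by norm_num) hk'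
      have h := (tendsto_rpow_neg_atTop hpos).comp hEφ
      have : (fun n => Es (φ n) ^ (1 / k - 1 / 2)) = (fun x : ℝ => x ^ (-(1 / 2 - 1 / k))) ∘ fun n => Es (φ n) := by
        funext n; simp only [Function.comp]; congr 1; ring
      rw [this]; exact h
  -- the limiting drift
  set D : RBPhaseSpace N → RBPhaseSpace N :=
    rbDriftOf (RBGrowth.limitForce hU.coeff k) (RBGrowth.limitForce hV.coeff k) P.γ Λ N c c with hD
  have hDc : Continuous D := continuous_rbDriftOf (RBGrowth.continuous_limitForce _ hk)
    (RBGrowth.continuous_limitForce _ hk) _ _ _ _ _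
  have hYeq : ∀ n z, Y n z = rbDriftOf (deriv (RBGrowth.scaledPot P.U k (Es n)))
      (deriv (RBGrowth.scaledPot P.V k (Es n))) P.γ Λ N (Es n ^ (2 / k - 1)) (Es n ^ (1 / k - 1 / 2)) z := by
    intro n z
    simp only [hY, OscillatorChain.rbDriftGen_eq_rbDriftOf, OscillatorChain.rbScaled_U,
      OscillatorChain.rbScaled_V, OscillatorChain.rbScaled_γ]
  -- KEY: uniform convergence of the drifts along the subsequence
  have HY : ∀ ε > 0, ∀ᶠ n in atTop, ∀ u ∈ Icc 0 Λ₀, ‖Y (φ n) (x (φ n) u) - D (g u)‖ ≤ ε := by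
    intro ε hε
    -- uniform continuity of `D` on `K`
    obtain ⟨ρ, hρ, hUC⟩ := Metric.uniformContinuousOn_iff.1
      (hKc.uniformContinuousOn_of_continuous hDc.continuousOn) (ε / 2) (by positivity)
    have h1 := HX (ρ / 2) (by positivity)
    -- closeness of the forces and of the coefficients
    set εF : ℝ := ε / 12 with hεF
    have hεF0 : 0 < εF := by positivity
    set S : ℝ := 2 * |Λ| * R₁ + |P.γ| * R₁ with hS
    have hS0 : 0 ≤ S := by positivity
    set εc : ℝ := ε / (4 * (S + 1)) with hεc
    have hεc0 : 0 < εc := by positivity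
    have hεcS : εc * S ≤ ε / 4 := by
      rw [hεc, div_mul_eq_mul_div, div_le_div_iff₀ (by positivity) (by norm_num)]
      nlinarith
    have h2 := hEφ.eventually (hU.eventually_forall_abs_deriv_scaledPot_sub_limitForce_le hk B hεF0)
    have h3 := hEφ.eventually (hV.eventually_forall_abs_deriv_scaledPot_sub_limitForce_le hk (2 * B) hεF0)
    have h4 := eventually_abs_sub_le_of_tendsto hcp hεc0
    have h5 := eventually_abs_sub_le_of_tendsto hcr hεc0
    filter_upwards [h1, h2, h3, h4, h5] with n h1 h2 h3 h4 h5 u hu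
    obtain ⟨hq, -⟩ := hxb (φ n) u hu
    obtain ⟨hr₁, hr₂⟩ := hrb (φ n) u hu
    -- term A: `Ỹ_E(x) - D(x)`
    have hA : ‖Y (φ n) (x (φ n) u) - D (x (φ n) u)‖ ≤ ε / 2 := by
      rw [hYeq, hD]
      refine (norm_rbDriftOf_sub_rbDriftOf_le hεF0.le hεc0.le hR₁0 hq hr₁ hr₂
        (fun y hy => h2 y (abs_le.1 hy)) (fun y hy => h3 y (abs_le.1 hy)) h4 h5).trans ?_
      rw [← hS]
      linarith
    -- term B: `D(x) - D(g)`
    have hB : ‖D (x (φ n) u) - D (g u)‖ ≤ ε / 2 := by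
      have := hUC (x (φ n) u) (hxK (φ n) u hu) (g u) (hgK u hu)
        (by rw [dist_eq_norm]; linarith [h1 u hu])
      rw [dist_eq_norm] at this
      exact this.le
    calc ‖Y (φ n) (x (φ n) u) - D (g u)‖
        ≤ ‖Y (φ n) (x (φ n) u) - D (x (φ n) u)‖ + ‖D (x (φ n) u) - D (g u)‖ :=
          norm_sub_le_norm_sub_add_norm_sub _ _ _
      _ ≤ ε := by linarith
  -- the limit integral equation
  have hgIE : IsIntegralSolutionOn D (fun _ => g 0) g Λ₀ := by
    intro t ht
    have hA : Tendsto (fun n => y (φ n) t) atTop (𝓝 (g t)) :=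
      tendsto_of_forall_eventually_norm_sub_le fun ε hε => (hconv ε hε).mono fun n hn => hn t ht
    have hx0 : Tendsto (fun n => x (φ n) 0) atTop (𝓝 (g 0)) := HXpt 0 h0m
    have hI : Tendsto (fun n => ∫ u in (0:ℝ)..t, Y (φ n) (x (φ n) u)) atTop
        (𝓝 (∫ u in (0:ℝ)..t, D (g u))) := by
      refine intervalIntegral.tendsto_integral_filter_of_dominated_convergence (fun _ => M₁)
        (Eventually.of_forall fun n => ((hYxc (φ n)).aestronglyMeasurable).restrict)
        (Eventually.of_forall fun n => ae_of_all _ fun u hu => hYb (φ n) u ?_)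
        intervalIntegrable_const (ae_of_all _ fun u hu => ?_)
      · rw [Set.uIoc_of_le ht.1] at hu; exact ⟨hu.1.le, hu.2.trans ht.2⟩
      · rw [Set.uIoc_of_le ht.1] at hu
        exact tendsto_of_forall_eventually_norm_sub_le fun ε hε =>
          (HY ε hε).mono fun n hn => hn u ⟨hu.1.le, hu.2.trans ht.2⟩
    have hB : Tendsto (fun n => y (φ n) t) atTop (𝓝 (g 0 + ∫ u in (0:ℝ)..t, D (g u))) := by
      have : (fun n => y (φ n) t) = fun n => x (φ n) 0 + ∫ u in (0:ℝ)..t, Y (φ n) (x (φ n) u) :=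
        funext fun n => hyIE (φ n) t ht
      rw [this]
      exact hx0.add hI
    exact tendsto_nhds_unique hA hB
  -- the limit has vanishing dissipation
  have hgd : ∫ s in (0 : ℝ)..Λ₀, ((g s).2.1 ^ 2 + (g s).2.2 ^ 2) = 0 := by
    have hA : Tendsto (fun n => ∫ s in (0 : ℝ)..Λ₀, ((x (φ n) s).2.1 ^ 2 + (x (φ n) s).2.2 ^ 2))
        atTop (𝓝 0) := hdiss.comp hφt
    have hB : Tendsto (fun n => ∫ s in (0 : ℝ)..Λ₀, ((x (φ n) s).2.1 ^ 2 + (x (φ n) s).2.2 ^ 2))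
        atTop (𝓝 (∫ s in (0 : ℝ)..Λ₀, ((g s).2.1 ^ 2 + (g s).2.2 ^ 2))) := by
      have hmeas : ∀ n, Continuous fun s => (x (φ n) s).2.1 ^ 2 + (x (φ n) s).2.2 ^ 2 := fun n =>
        ((continuous_fst.comp (continuous_snd.comp (hxc (φ n)))).pow 2).add
          ((continuous_snd.comp (continuous_snd.comp (hxc (φ n)))).pow 2)
      refine intervalIntegral.tendsto_integral_filter_of_dominated_convergence (fun _ => R₁ ^ 2 + R₁ ^ 2)
        (Eventually.of_forall fun n => ((hmeas n).aestronglyMeasurable).restrict)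
        (Eventually.of_forall fun n => ae_of_all _ fun u hu => ?_)
        intervalIntegrable_const (ae_of_all _ fun u hu => ?_)
      · rw [Set.uIoc_of_le hΛ₀.le] at hu
        obtain ⟨h1, h2⟩ := hrb (φ n) u ⟨hu.1.le, hu.2⟩
        rw [Real.norm_eq_abs, abs_of_nonneg (by positivity)]
        have ha : (x (φ n) u).2.1 ^ 2 ≤ R₁ ^ 2 := by
          rw [← sq_abs]; exact pow_le_pow_left₀ (abs_nonneg _) h1 2
        have hb : (x (φ n) u).2.2 ^ 2 ≤ R₁ ^ 2 := by
          rw [← sq_abs]; exact pow_le_pow_left₀ (abs_nonneg _) h2 2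
        linarith
      · rw [Set.uIoc_of_le hΛ₀.le] at hu
        have h := HXpt u ⟨hu.1.le, hu.2⟩
        have hF : Continuous fun v : RBPhaseSpace N => v.2.1 ^ 2 + v.2.2 ^ 2 := by fun_prop
        exact (hF.tendsto (g u)).comp h
    exact tendsto_nhds_unique hB hA
  -- hence the limit starts at the origin
  have hg0 : g 0 = 0 := by
    obtain ⟨h1, h2, h3⟩ := limit_initial_eq_zero hU.coeff_pos hV.coeff_pos hk hΛ hN hgc hΛ₀ hgIE hgd
    exact Prod.ext (Prod.ext h1 h2) h3
  -- but the rescaled energies at time `0` are at least `1/2`: contradiction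
  obtain ⟨CU, CV, hCU, hCV, hGle⟩ := rbScaledEnergy_le_of_norm_le hU hV hk (N := N)
  set b : ℕ → ℝ := fun n => ‖x (φ n) 0‖ ^ 2 + N * (‖x (φ n) 0‖ ^ 2 / 2 +
      CU * (1 / Es (φ n) + ‖x (φ n) 0‖ ^ k)) + N * (N * (CV * (1 / Es (φ n) + (2 * ‖x (φ n) 0‖) ^ k))) with hb
  have hρ : Tendsto (fun n => ‖x (φ n) 0‖) atTop (𝓝 0) := by
    have := (HXpt 0 h0m).sub_const (g 0)
    rw [sub_self] at this
    have := this.norm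
    simpa [hg0] using this
  have hinv : Tendsto (fun n => 1 / Es (φ n)) atTop (𝓝 0) := by
    have := tendsto_inv_atTop_zero.comp hEφ
    simpa [Function.comp_def] using this
  have hbt : Tendsto b atTop (𝓝 0) := by
    have hρ2 : Tendsto (fun n => ‖x (φ n) 0‖ ^ 2) atTop (𝓝 0) := by
      simpa using hρ.pow 2
    have hρk : Tendsto (fun n => ‖x (φ n) 0‖ ^ k) atTop (𝓝 0) := by
      have := hρ.rpow_const (p := k) (Or.inr hk0.le)
      simpa [Real.zero_rpow hk0.ne'] using this
    have hρk2 : Tendsto (fun n => (2 * ‖x (φ n) 0‖) ^ k) atTop (𝓝 0) := by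
      have h2ρ : Tendsto (fun n => 2 * ‖x (φ n) 0‖) atTop (𝓝 0) := by
        simpa using hρ.const_mul 2
      have := h2ρ.rpow_const (p := k) (Or.inr hk0.le)
      simpa [Real.zero_rpow hk0.ne'] using this
    have := (hρ2.add ((((hρ2.div_const 2).add ((hinv.add hρk).const_mul CU))).const_mul (N : ℝ))).add
      ((((hinv.add hρk2).const_mul CV).const_mul (N : ℝ)).const_mul (N : ℝ))
    rw [show (0:ℝ) + (N : ℝ) * (0 / 2 + CU * (0 + 0)) + (N : ℝ) * ((N : ℝ) * (CV * (0 + 0))) = 0 by ring] at this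
    exact this
  obtain ⟨n, hn⟩ := (hbt.eventually_lt_const (by norm_num : (0 : ℝ) < 1 / 2)).exists
  have h1 := hGle (Es (φ n)) (hE1 (φ n)) (x (φ n) 0) ‖x (φ n) 0‖ le_rfl
  have h2 := hG0 (φ n)
  have : P.rbScaledEnergy k (Es (φ n)) N (x (φ n) 0) ≤ b n := by rw [hb]; exact h1
  linarith

end Core

/-! ### Theorem 3.3 / Corollary 3.6 in quantitative rescaled form -/

section Main

open Literature.Analysis.ODE Literature.MathematicalPhysics.KineticTheory Metric

variable {N : ℕ}

/-- **Reservoir variables move slowly**: for `x = x(0) + (0, η) + ∫ F(x)` on `[0, T]` with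
`‖F(x(s))‖ ≤ M₁`, `|r_b(s) - r_b(0) - η_b(s)| ≤ M₁ T`. [folklore] -/
theorem reservoir_deviation_le {F : RBPhaseSpace N → RBPhaseSpace N}
    {x : ℝ → RBPhaseSpace N} {η : ℝ → ℝ × ℝ} {T M₁ : ℝ} (hM₁ : 0 ≤ M₁)
    (hx : IsIntegralSolutionOn F (fun s => x 0 + ((0 : PhaseSpace N), η s)) x T)
    (hb : ∀ s ∈ Icc 0 T, ‖F (x s)‖ ≤ M₁) :
    ∀ s ∈ Icc 0 T, |(x s).2.1 - (x 0).2.1 - (η s).1| ≤ M₁ * T ∧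
      |(x s).2.2 - (x 0).2.2 - (η s).2| ≤ M₁ * T := by
  intro s hs
  have h1 := hx s hs
  have hI : ‖∫ u in (0:ℝ)..s, F (x u)‖ ≤ M₁ * T := by
    refine (intervalIntegral.norm_integral_le_of_norm_le_const fun u hu => hb u ?_).trans ?_
    · rw [Set.uIoc_of_le hs.1] at hu; exact ⟨hu.1.le, hu.2.trans hs.2⟩
    · rw [sub_zero, abs_of_nonneg hs.1]; exact mul_le_mul_of_nonneg_left hs.2 hM₁
  obtain ⟨-, -, e1, e2⟩ := abs_le_norm_rbPhaseSpace (∫ u in (0:ℝ)..s, F (x u))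
  have c1 : (x s).2.1 - (x 0).2.1 - (η s).1 = (∫ u in (0:ℝ)..s, F (x u)).2.1 := by
    have := congrArg (fun v : RBPhaseSpace N => v.2.1) h1
    simp only [Prod.snd_add, Prod.fst_add] at this
    linarith
  have c2 : (x s).2.2 - (x 0).2.2 - (η s).2 = (∫ u in (0:ℝ)..s, F (x u)).2.2 := by
    have := congrArg (fun v : RBPhaseSpace N => v.2.2) h1
    simp only [Prod.snd_add] at this
    linarith
  rw [c1, c2]
  exact ⟨e1.trans hI, e2.trans hI⟩

variable {P : OscillatorChain} {k : ℝ} (hU : RBGrowth P.U k) (hV : RBGrowth P.V k)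
  (hk : 2 ≤ k) {Λ : ℝ} (hΛ : Λ ≠ 0) (hN : 0 < N) {Λ₀ : ℝ} (hΛ₀ : 0 < Λ₀)
include hU hV hk hΛ hN hΛ₀

/-- **Theorem 3.3 / Corollary 3.6 of Rey-Bellet–Thomas (quantitative rescaled form, equal
exponents `k₁ = k₂ = k ≥ 2`).** Fix the macroscopic time `Λ₀ > 0` and an energy ceiling `M`.
There are `E₀ ≥ 1`, `δ₀ ∈ (0, 1]` and `ε₁ > 0` such that for every energy `E ≥ E₀`, every
continuous solution `x̃ = x̃(0) + (0, η̃) + ∫ Ỹ_E(x̃)` of the rescaled controlled equations (20) on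
`[0, Λ₀]` with rescaled energy `G̃_E(x̃(0)) ≥ 1/2`, `G̃_E(x̃(s)) ≤ M` on `[0, Λ₀]` and control
`sup ‖η̃‖ ≤ δ₀` dissipates: `∫₀^{Λ₀} (r̃_L² + r̃_R²) ds ≥ ε₁`. (The printed Cor. 3.6 is the
`Λ`-noise version "the dissipation is `≥ c` uniformly near the energy shell"; the compactness
argument is that of Thm 3.3: a sequence of bad trajectories with `E_n → ∞` has a subsequence whose
drift-driven parts converge to a solution of the limiting system (21) with zero dissipation,
forcing the initial point to be the critical point `0`, contradicting `G̃ ≥ 1/2`.)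
[cite: ReyBelletThomas2002, Thm 3.3, Cor 3.6 (proof)] -/
theorem scaled_dissipation_lower_bound (M : ℝ) :
    ∃ E₀ δ₀ ε₁ : ℝ, 1 ≤ E₀ ∧ 0 < δ₀ ∧ δ₀ ≤ 1 ∧ 0 < ε₁ ∧ ∀ E : ℝ, E₀ ≤ E →
      ∀ (x : ℝ → RBPhaseSpace N) (η : ℝ → ℝ × ℝ), Continuous x →
        IsIntegralSolutionOn ((P.rbScaled k E).rbDriftGen Λ N (E ^ (2 / k - 1)) (E ^ (1 / k - 1 / 2)))
          (fun s => x 0 + ((0 : PhaseSpace N), η s)) x Λ₀ →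
        1 / 2 ≤ P.rbScaledEnergy k E N (x 0) →
        (∀ s ∈ Icc 0 Λ₀, ‖η s‖ ≤ δ₀) → (∀ s ∈ Icc 0 Λ₀, P.rbScaledEnergy k E N (x s) ≤ M) →
        ε₁ ≤ ∫ s in (0 : ℝ)..Λ₀, ((x s).2.1 ^ 2 + (x s).2.2 ^ 2) := by
  obtain ⟨B, Cp, Cr, M₁, hB, hCp, hCr, hM₁, hbd⟩ := scaled_drift_bound hU hV hk Λ N M
  set R₀ : ℝ := 2 + M₁ * Λ₀ with hR₀
  -- Case A (bounded initial reservoir variables): the compactness argument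
  have caseA : ∃ E₀ δ₀ ε₁ : ℝ, 1 ≤ E₀ ∧ 0 < δ₀ ∧ δ₀ ≤ 1 ∧ 0 < ε₁ ∧ ∀ E : ℝ, E₀ ≤ E →
      ∀ (x : ℝ → RBPhaseSpace N) (η : ℝ → ℝ × ℝ), Continuous x →
        IsIntegralSolutionOn ((P.rbScaled k E).rbDriftGen Λ N (E ^ (2 / k - 1)) (E ^ (1 / k - 1 / 2)))
          (fun s => x 0 + ((0 : PhaseSpace N), η s)) x Λ₀ →
        1 / 2 ≤ P.rbScaledEnergy k E N (x 0) → |(x 0).2.1| ≤ R₀ → |(x 0).2.2| ≤ R₀ →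
        (∀ s ∈ Icc 0 Λ₀, ‖η s‖ ≤ δ₀) → (∀ s ∈ Icc 0 Λ₀, P.rbScaledEnergy k E N (x s) ≤ M) →
        ε₁ ≤ ∫ s in (0 : ℝ)..Λ₀, ((x s).2.1 ^ 2 + (x s).2.2 ^ 2) := by
    by_contra H
    have H' : ∀ n : ℕ, ∃ (E : ℝ) (x : ℝ → RBPhaseSpace N) (η : ℝ → ℝ × ℝ), (n : ℝ) + 1 ≤ E ∧
        Continuous x ∧
        IsIntegralSolutionOn ((P.rbScaled k E).rbDriftGen Λ N (E ^ (2 / k - 1)) (E ^ (1 / k - 1 / 2)))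
          (fun s => x 0 + ((0 : PhaseSpace N), η s)) x Λ₀ ∧
        1 / 2 ≤ P.rbScaledEnergy k E N (x 0) ∧ |(x 0).2.1| ≤ R₀ ∧ |(x 0).2.2| ≤ R₀ ∧
        (∀ s ∈ Icc 0 Λ₀, ‖η s‖ ≤ 1 / ((n : ℝ) + 1)) ∧
        (∀ s ∈ Icc 0 Λ₀, P.rbScaledEnergy k E N (x s) ≤ M) ∧
        ∫ s in (0 : ℝ)..Λ₀, ((x s).2.1 ^ 2 + (x s).2.2 ^ 2) < 1 / ((n : ℝ) + 1) := by
      intro n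
      by_contra h'
      apply H
      have hn1 : (1 : ℝ) ≤ (n : ℝ) + 1 := by
        have : (0 : ℝ) ≤ n := Nat.cast_nonneg n
        linarith
      refine ⟨(n : ℝ) + 1, 1 / ((n : ℝ) + 1), 1 / ((n : ℝ) + 1), hn1, by positivity,
        (div_le_one (by positivity)).2 hn1, by positivity,
        fun E hE x η hxc hIE hG hr1 hr2 hη hGM => ?_⟩
      by_contra hlt
      exact h' ⟨E, x, η, hE, hxc, hIE, hG, hr1, hr2, hη, hGM, not_le.1 hlt⟩
    choose Es xs ηs hEs hxsc hIE hG hr1 hr2 hηs hGMs hlt using H'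
    have hn1 : ∀ n : ℕ, (1 : ℝ) ≤ (n : ℝ) + 1 := fun n => by
      have : (0 : ℝ) ≤ n := Nat.cast_nonneg n
      linarith
    have hEt : Tendsto Es atTop atTop :=
      tendsto_atTop_mono hEs (tendsto_natCast_atTop_atTop.atTop_add tendsto_const_nhds)
    refine scaled_core_seq hU hV hk hΛ hN hΛ₀ (M := M) (R₀ := R₀) (Es := Es)
      (δ := fun n => 1 / ((n : ℝ) + 1)) (x := xs) (η := ηs) (fun n => (hn1 n).trans (hEs n)) hEt
      tendsto_one_div_add_atTop_nhds_zero_nat (fun n => (div_le_one (by positivity)).2 (hn1 n))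
      hxsc hIE hG (fun n => ⟨hr1 n, hr2 n⟩) hηs hGMs ?_
    refine squeeze_zero (fun n => intervalIntegral.integral_nonneg hΛ₀.le fun s _ => by positivity)
      (fun n => (hlt n).le) tendsto_one_div_add_atTop_nhds_zero_nat
  obtain ⟨E₀, δ₀, ε₁, hE₀, hδ₀, hδ₁, hε₁, hA⟩ := caseA
  refine ⟨E₀, δ₀, min ε₁ Λ₀, hE₀, hδ₀, hδ₁, lt_min hε₁ hΛ₀, fun E hE x η hxc hIE hG hη hGM => ?_⟩
  by_cases hr : |(x 0).2.1| ≤ R₀ ∧ |(x 0).2.2| ≤ R₀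
  · exact (min_le_left _ _).trans (hA E hE x η hxc hIE hG hr.1 hr.2 hη hGM)
  · -- Case B (a large initial reservoir variable): it stays `≥ 1` on `[0, Λ₀]`
    have hE1 : 1 ≤ E := hE₀.trans hE
    have hdev := reservoir_deviation_le hM₁ hIE (fun s hs => (hbd E hE1 (x s) (hGM s hs)).2.2.2.2)
    have hηc : ∀ s ∈ Icc 0 Λ₀, |(η s).1| ≤ 1 ∧ |(η s).2| ≤ 1 := fun s hs =>
      ⟨((Real.norm_eq_abs _).symm.le.trans (norm_fst_le (η s))).trans ((hη s hs).trans hδ₁),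
        ((Real.norm_eq_abs _).symm.le.trans (norm_snd_le (η s))).trans ((hη s hs).trans hδ₁)⟩
    have hlow : ∀ s ∈ Icc 0 Λ₀, (1 : ℝ) ≤ (x s).2.1 ^ 2 + (x s).2.2 ^ 2 := by
      intro s hs
      obtain ⟨d1, d2⟩ := hdev s hs
      obtain ⟨n1, n2⟩ := hηc s hs
      rcases not_and_or.1 hr with h | h
      · have h' : R₀ < |(x 0).2.1| := not_le.1 h
        have : 1 ≤ |(x s).2.1| := by
          have := abs_sub_abs_le_abs_sub (x 0).2.1 (x s).2.1
          have e : (x 0).2.1 - (x s).2.1 = -((x s).2.1 - (x 0).2.1 - (η s).1) - (η s).1 := by ring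
          rw [e] at this
          have h3 : |-((x s).2.1 - (x 0).2.1 - (η s).1)| + |(η s).1| ≤ M₁ * Λ₀ + 1 := by
            rw [abs_neg]; exact add_le_add d1 n1
          have := (this.trans (abs_sub _ _)).trans h3
          rw [hR₀] at h'; linarith
        nlinarith [abs_nonneg (x s).2.1, sq_abs (x s).2.1, sq_nonneg (x s).2.2]
      · have h' : R₀ < |(x 0).2.2| := not_le.1 h
        have : 1 ≤ |(x s).2.2| := by
          have := abs_sub_abs_le_abs_sub (x 0).2.2 (x s).2.2
          have e : (x 0).2.2 - (x s).2.2 = -((x s).2.2 - (x 0).2.2 - (η s).2) - (η s).2 := by ring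
          rw [e] at this
          have h3 : |-((x s).2.2 - (x 0).2.2 - (η s).2)| + |(η s).2| ≤ M₁ * Λ₀ + 1 := by
            rw [abs_neg]; exact add_le_add d2 n2
          have := (this.trans (abs_sub _ _)).trans h3
          rw [hR₀] at h'; linarith
        nlinarith [abs_nonneg (x s).2.2, sq_abs (x s).2.2, sq_nonneg (x s).2.1]
    have hcont : Continuous fun s => (x s).2.1 ^ 2 + (x s).2.2 ^ 2 := by fun_prop
    have hmono := intervalIntegral.integral_mono_on (μ := volume) hΛ₀.le intervalIntegrable_const
      (hcont.intervalIntegrable _ _) hlow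
    rw [intervalIntegral.integral_const, smul_eq_mul, mul_one, sub_zero] at hmono
    exact (min_le_right _ _).trans hmono

end Main

end Literature.MathematicalPhysics.KineticTheory.HeatConduction

end
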